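import Summits.HubbardSuperconductivity.HubbardSuperconductivity.Theorems.AnisotropyChordTransferFibre3Hole2Green

/-!
# Route `AnisotropyChord` / H0 rotor rung: FIN layer 0 — λ-CELL enclosures of the torus kernel `Gres L λ r` (kernel evaluator + soundness)

The FIN half of the GM₃ ∀L certificate (LEVEL2-SPEC §4; director ruling 2026-08-30 D2 route (b)) evaluates every crux quantity at
fixed `L` on λ-CELLS `λ ∈ [λa, λb]` of the a-priori window (`…Fibre3CruxWindow`), the ground profile being the explicit function
`groundF L λ` of the torus kernel (`…Fibre3GroundExplicit`).  This file is the bottom layer of that evaluator: enclosures, valid for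
EVERY `λ` in a fixed-point cell, of the KT-normalised zero-mode-removed kernel
`Gres L λ (r₁,r₂) = (1/V) Σ_{k≠0} cos(k·r)/(2ε(k) − λ)` (PORT PartN37), by g3's zero-data double-sum tables (`…Fibre3Hole2Check.greenIv`,
`gSum`, `gRow` are generic in the reciprocal table) with a CELL reciprocal table:
* `denCellIv`, `gresCellTab L ct la lb` — fixed-point enclosures of `1/(2ε(k) − λ)` for all `λ ∈ [la/D, lb/D]`
  (`1/(2ε − λ)` is increasing in `λ`), `denCellPos` (every denominator has a positive lower end);
* ★ `mem_green_of` — GENERIC soundness of g3's double sum: any table enclosing the values `w k₁ k₂` entrywise encloses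
  `(1/V)Σ_{k≠0} cos(k·r)·w(k)` (so the squared / product tables of the Lipschitz layer reuse the same lemma);
* ★ `mem_Gres_cell` — `λ·D ∈ [la, lb] ⇒ Gres L λ (r₁,r₂) ∈ greenIv L (cosTab L) (gresCellTab L … la lb) r₁ r₂`;
* ★ `Gres_sub_Gres` + `mem_GresSlope_cell` — the CALCULUS-FREE Taylor-1 control on a cell:
  `Gres λ r − Gres λ' r = (λ − λ') · (1/V)Σ_{k≠0} cos(k·r)/((2ε−λ)(2ε−λ'))`, the slope sum enclosed by the table of products.
Cost `O(V)` interval operations per value (`L ≤ 31`: the whole window table in seconds); the `O(L)` row-formula evaluator for large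
`L` is a later layer.  Prover seat `hubbard-h0-rotor-p3` g4; helper for stmt-HubbardSuperconductivity-23918 (piece A of the split rung
19089; `--supports`, helper class).
WHAT THIS IS NOT: nothing here proves superconductivity in the Hubbard model (rotor TARGET as worded stays FALSE, g15 verdict); it is
evaluator infrastructure for the FIN certificates of ONE conditional reduction. Tree imports only; no sorry, no axioms.
-/

set_option linter.dupNamespace false
set_option autoImplicit false

namespace Summit.HubbardSuperconductivity.HubbardSuperconductivity.Theorems.AnisotropyChord.Transfer.Fibre3

namespace FinCell

open scoped BigOperators
open Finset Hole2

/-! ## The cell reciprocal table (computable, zero data) -/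

/-- enclosure of `2ε(k) − λ` for every `λ` with `λ·D ∈ [la, lb]`: `[4D − 2hi₁ − 2hi₂ − lb, 4D − 2lo₁ − 2lo₂ − la]`. [folklore] -/
def denCellIv (ct : List Iv) (la lb : ℤ) (k1 k2 : ℕ) : Iv :=
  (4 * D - 2 * (getIv ct k1).2 - 2 * (getIv ct k2).2 - lb, 4 * D - 2 * (getIv ct k1).1 - 2 * (getIv ct k2).1 - la)

/-- every `2ε(k) − λ`, `k ≠ 0`, has a positive lower end on the cell (so that `iinv` is sound). [folklore] -/
def denCellPos (L : ℕ) (ct : List Iv) (la lb : ℤ) : Bool :=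
  (List.range L).all fun k1 => (List.range L).all fun k2 =>
    (k1 == 0 && k2 == 0) || decide (0 < (denCellIv ct la lb k1 k2).1)

/-- the cell table of enclosures of `g(k) = 1/(2ε(k) − λ)` (row `k₁`, column `k₂`; the `(0,0)` entry is never used). [folklore] -/
def gresCellTab (L : ℕ) (ct : List Iv) (la lb : ℤ) : List (List Iv) :=
  (List.range L).map fun k1 => (List.range L).map fun k2 => iinv (denCellIv ct la lb k1 k2)

/-- the cell table of enclosures of the slope weights `1/((2ε(k) − λ)(2ε(k) − λ'))`, `λ, λ'` in the cell. [folklore] -/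
def gresSqCellTab (L : ℕ) (ct : List Iv) (la lb : ℤ) : List (List Iv) :=
  (List.range L).map fun k1 => (List.range L).map fun k2 =>
    imul (iinv (denCellIv ct la lb k1 k2)) (iinv (denCellIv ct la lb k1 k2))

/-- ★ enclosure of `Gres L λ (r₁,r₂)` valid on the whole cell (g3's double sum over the cell table). [folklore] -/
def GresCellIv (L : ℕ) (la lb : ℤ) (r1 r2 : ℕ) : Iv :=
  greenIv L (cosTab L) (gresCellTab L (cosTab L) la lb) r1 r2

/-- ★ enclosure of the cell slope sum `(1/V)Σ_{k≠0} cos(k·r)/((2ε−λ)(2ε−λ'))`. [folklore] -/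
def GresSlopeIv (L : ℕ) (la lb : ℤ) (r1 r2 : ℕ) : Iv :=
  greenIv L (cosTab L) (gresSqCellTab L (cosTab L) la lb) r1 r2

/-! ## Generic soundness of the double sum -/

/-- the weighted summand: `0` at `k = 0`, else `cos(2π((k₁r₁ + k₂r₂) mod L)/L) · w k₁ k₂`. [folklore] -/
noncomputable def wterm (L : ℕ) (w : ℕ → ℕ → ℝ) (r1 r2 k1 k2 : ℕ) : ℝ :=
  if k1 = 0 ∧ k2 = 0 then 0 else Real.cos (2 * Real.pi * ((k1 * r1 + k2 * r2) % L : ℕ) / L) * w k1 k2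

/-- row of a `range`-built table. [folklore] -/
theorem tab_row {L : ℕ} (F : ℕ → ℕ → Iv) {k1 : ℕ} (hk1 : k1 < L) :
    (((List.range L).map fun a => (List.range L).map fun b => F a b).getD k1 [])
      = (List.range L).map fun b => F k1 b := by
  exact getD_map_range _ _ hk1

/-- entry of a `range`-built table. [folklore] -/
theorem getIv_tab {L : ℕ} (F : ℕ → ℕ → Iv) {k1 k2 : ℕ} (hk1 : k1 < L) (hk2 : k2 < L) :
    getIv ((((List.range L).map fun a => (List.range L).map fun b => F a b).getD k1 [])) k2 = F k1 k2 := by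
  rw [tab_row F hk1]
  unfold getIv
  exact getD_map_range _ _ hk2

/-- each weighted summand is enclosed, given an entrywise enclosure of the weights. [folklore] -/
theorem mem_wterm (L : ℕ) (hL : 3 ≤ L) (w : ℕ → ℕ → ℝ) (et : List (List Iv))
    (hent : ∀ k1 k2 : ℕ, k1 < L → k2 < L → ¬ (k1 = 0 ∧ k2 = 0) → mem (w k1 k2) (getIv (et.getD k1 []) k2))
    (r1 r2 : ℕ) {k1 k2 : ℕ} (hk1 : k1 < L) (hk2 : k2 < L) (hk : ¬ (k1 = 0 ∧ k2 = 0)) :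
    mem (wterm L w r1 r2 k1 k2) (imul (getIv (cosTab L) ((k1 * r1 + k2 * r2) % L)) (getIv (et.getD k1 []) k2)) := by
  have hL0 : 0 < L := by omega
  unfold wterm
  rw [if_neg hk]
  have hm : (k1 * r1 + k2 * r2) % L < L := Nat.mod_lt _ hL0
  rw [getIv_cosTab hm]
  exact mem_imul (mem_cosIv hL hm) (hent k1 k2 hk1 hk2 hk)

/-- row induction. [folklore] -/
theorem mem_gRow_of (L : ℕ) (hL : 3 ≤ L) (w : ℕ → ℕ → ℝ) (et : List (List Iv))
    (hent : ∀ k1 k2 : ℕ, k1 < L → k2 < L → ¬ (k1 = 0 ∧ k2 = 0) → mem (w k1 k2) (getIv (et.getD k1 []) k2))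
    (r1 r2 : ℕ) {k1 : ℕ} (hk1 : k1 < L) : ∀ n : ℕ, n ≤ L →
      mem (∑ k2 ∈ range n, wterm L w r1 r2 k1 k2) (gRow L (cosTab L) (et.getD k1 []) r1 r2 k1 n) := by
  intro n
  induction n with
  | zero =>
    intro _
    rw [Finset.sum_range_zero]
    have := mem_exact 0
    push_cast at this
    rw [zero_div] at this
    exact this
  | succ n ih =>
    intro hn
    have hn' : n < L := hn
    rw [Finset.sum_range_succ]
    unfold gRow
    by_cases hk : k1 = 0 ∧ n = 0
    · rw [if_pos hk]
      have hz : wterm L w r1 r2 k1 n = 0 := by unfold wterm; rw [if_pos hk]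
      rw [hz, add_zero]
      exact ih (by omega)
    · rw [if_neg hk]
      exact mem_iadd (ih (by omega)) (mem_wterm L hL w et hent r1 r2 hk1 hn' hk)

/-- spine induction. [folklore] -/
theorem mem_gSum_of (L : ℕ) (hL : 3 ≤ L) (w : ℕ → ℕ → ℝ) (et : List (List Iv))
    (hent : ∀ k1 k2 : ℕ, k1 < L → k2 < L → ¬ (k1 = 0 ∧ k2 = 0) → mem (w k1 k2) (getIv (et.getD k1 []) k2))
    (r1 r2 : ℕ) : ∀ n : ℕ, n ≤ L →
      mem (∑ k1 ∈ range n, ∑ k2 ∈ range L, wterm L w r1 r2 k1 k2) (gSum L (cosTab L) et r1 r2 n) := by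
  intro n
  induction n with
  | zero =>
    intro _
    rw [Finset.sum_range_zero]
    have := mem_exact 0
    push_cast at this
    rw [zero_div] at this
    exact this
  | succ n ih =>
    intro hn
    rw [Finset.sum_range_succ]
    unfold gSum
    exact mem_iadd (ih (by omega)) (mem_gRow_of L hL w et hent r1 r2 (show n < L from hn) L le_rfl)

/-- ★ GENERIC SOUNDNESS: `(Σ_{k₁,k₂<L} wterm)/L² ∈ greenIv L (cosTab L) et r₁ r₂` for any table enclosing the weights. [folklore] -/
theorem mem_green_of (L : ℕ) (hL : 3 ≤ L) (w : ℕ → ℕ → ℝ) (et : List (List Iv))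
    (hent : ∀ k1 k2 : ℕ, k1 < L → k2 < L → ¬ (k1 = 0 ∧ k2 = 0) → mem (w k1 k2) (getIv (et.getD k1 []) k2))
    (r1 r2 : ℕ) :
    mem ((∑ k1 ∈ range L, ∑ k2 ∈ range L, wterm L w r1 r2 k1 k2) / (L : ℝ) ^ 2) (greenIv L (cosTab L) et r1 r2) := by
  unfold greenIv
  have hLL : (0 : ℤ) < (L : ℤ) * L := by
    have : (0 : ℤ) < L := by exact_mod_cast (show 0 < L by omega)
    positivity
  have h := mem_idivn (mem_gSum_of L hL w et hent r1 r2 L le_rfl) hLL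
  push_cast at h
  rw [sq]
  exact h

/-! ## `Gres` as a double `range` sum -/

/-- the weight `1/(2ε(k) − λ)` at natural coordinates. [folklore] -/
noncomputable def gw (L : ℕ) (lam : ℝ) (k1 k2 : ℕ) : ℝ := 1 / (2 * epsN L k1 k2 - lam)

/-- `Gres L λ (r₁,r₂) = (Σ_{k₁,k₂<L} wterm (gw λ))/L²` (`r₁, r₂ < L`). [folklore] -/
theorem Gres_eq_sum (L : ℕ) [NeZero L] (lam : ℝ) {r1 r2 : ℕ} (h1 : r1 < L) (h2 : r2 < L) :
    Gres L lam (((r1 : ℕ) : ZMod L), ((r2 : ℕ) : ZMod L))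
      = (∑ k1 ∈ range L, ∑ k2 ∈ range L, wterm L (gw L lam) r1 r2 k1 k2) / (L : ℝ) ^ 2 := by
  have hL : 0 < L := Nat.pos_of_ne_zero (NeZero.ne L)
  unfold Gres
  congr 1
  rw [sum_tor_range]
  refine Finset.sum_congr rfl fun k1 hk1 => Finset.sum_congr rfl fun k2 hk2 => ?_
  rw [Finset.mem_range] at hk1 hk2
  unfold wterm gres gw
  have hzero : ((((k1 : ℕ) : ZMod L), ((k2 : ℕ) : ZMod L)) : Tor L) = 0 ↔ (k1 = 0 ∧ k2 = 0) := by
    rw [Prod.mk_eq_zero, natCast_zmod_eq_zero L hk1, natCast_zmod_eq_zero L hk2]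
  by_cases hk : k1 = 0 ∧ k2 = 0
  · rw [if_pos (hzero.mpr hk), if_pos hk, zero_mul]
  · rw [if_neg (fun h => hk (hzero.mp h)), if_neg hk, RateLemma.phase_re]
    simp only [ZMod.val_natCast, Nat.mod_eq_of_lt hk1, Nat.mod_eq_of_lt hk2, Nat.mod_eq_of_lt h1, Nat.mod_eq_of_lt h2]
    rw [cos_mod L hL, epsT_natCast L hk1 hk2]
    unfold epsN
    ring

/-! ## Soundness of the cell table -/

/-- the denominator enclosure: `λ·D ∈ [la, lb] ⇒ 2ε(k) − λ ∈ denCellIv`. [folklore] -/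
theorem mem_denCell (L : ℕ) (hL : 3 ≤ L) {lam : ℝ} {la lb : ℤ}
    (hla : (la : ℝ) ≤ lam * ((D : ℤ) : ℝ)) (hlb : lam * ((D : ℤ) : ℝ) ≤ (lb : ℝ))
    {k1 k2 : ℕ} (h1 : k1 < L) (h2 : k2 < L) :
    mem (2 * epsN L k1 k2 - lam) (denCellIv (cosTab L) la lb k1 k2) := by
  unfold denCellIv epsN
  rw [getIv_cosTab h1, getIv_cosTab h2]
  obtain ⟨c1l, c1h⟩ := mem_cosIv hL h1
  obtain ⟨c2l, c2h⟩ := mem_cosIv hL h2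
  have hD := D_pos
  constructor
  · push_cast; nlinarith
  · push_cast; nlinarith

/-- the positivity check, unpacked. [folklore] -/
theorem denCellPos_spec {L : ℕ} {ct : List Iv} {la lb : ℤ} (h : denCellPos L ct la lb = true) {k1 k2 : ℕ}
    (hk1 : k1 < L) (hk2 : k2 < L) (hk : ¬ (k1 = 0 ∧ k2 = 0)) : 0 < (denCellIv ct la lb k1 k2).1 := by
  unfold denCellPos at h
  rw [List.all_eq_true] at h
  have h1 := h k1 (List.mem_range.mpr hk1)
  rw [List.all_eq_true] at h1
  have h2 := h1 k2 (List.mem_range.mpr hk2)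
  rw [Bool.or_eq_true, Bool.and_eq_true, beq_iff_eq, beq_iff_eq, decide_eq_true_eq] at h2
  rcases h2 with h2 | h2
  · exact absurd h2 hk
  · exact h2

/-- entrywise soundness of the cell reciprocal table. [folklore] -/
theorem mem_gresCellTab (L : ℕ) (hL : 3 ≤ L) {lam : ℝ} {la lb : ℤ}
    (hla : (la : ℝ) ≤ lam * ((D : ℤ) : ℝ)) (hlb : lam * ((D : ℤ) : ℝ) ≤ (lb : ℝ))
    (hpos : denCellPos L (cosTab L) la lb = true) :
    ∀ k1 k2 : ℕ, k1 < L → k2 < L → ¬ (k1 = 0 ∧ k2 = 0) →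
      mem (gw L lam k1 k2) (getIv ((gresCellTab L (cosTab L) la lb).getD k1 []) k2) := by
  intro k1 k2 hk1 hk2 hk
  unfold gresCellTab
  rw [getIv_tab (fun a b => iinv (denCellIv (cosTab L) la lb a b)) hk1 hk2]
  unfold gw
  exact mem_iinv (mem_denCell L hL hla hlb hk1 hk2) (denCellPos_spec hpos hk1 hk2 hk)

/-- ★ THE CELL ENCLOSURE: for every `λ` with `λ·D ∈ [la, lb]` (and the positivity check),
`Gres L λ (r₁,r₂) ∈ GresCellIv L la lb r₁ r₂` (`r₁, r₂ < L`). [folklore] -/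
theorem mem_Gres_cell (L : ℕ) [NeZero L] (hL : 3 ≤ L) {lam : ℝ} {la lb : ℤ}
    (hla : (la : ℝ) ≤ lam * ((D : ℤ) : ℝ)) (hlb : lam * ((D : ℤ) : ℝ) ≤ (lb : ℝ))
    (hpos : denCellPos L (cosTab L) la lb = true) {r1 r2 : ℕ} (h1 : r1 < L) (h2 : r2 < L) :
    mem (Gres L lam (((r1 : ℕ) : ZMod L), ((r2 : ℕ) : ZMod L))) (GresCellIv L la lb r1 r2) := by
  rw [Gres_eq_sum L lam h1 h2]
  exact mem_green_of L hL (gw L lam) _ (mem_gresCellTab L hL hla hlb hpos) r1 r2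

/-! ## The calculus-free Taylor-1 control: difference quotients on a cell -/

/-- the slope weight `1/((2ε(k) − λ)(2ε(k) − λ'))`. [folklore] -/
noncomputable def sw (L : ℕ) (lam lam' : ℝ) (k1 k2 : ℕ) : ℝ := 1 / ((2 * epsN L k1 k2 - lam) * (2 * epsN L k1 k2 - lam'))

/-- the slope sum `(Σ_{k₁,k₂<L} wterm (sw λ λ'))/L²` (`= (1/V)Σ_{k≠0} cos(k·r)/((2ε−λ)(2ε−λ'))`). [folklore] -/
noncomputable def slopeSum (L : ℕ) (lam lam' : ℝ) (r1 r2 : ℕ) : ℝ :=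
  (∑ k1 ∈ range L, ∑ k2 ∈ range L, wterm L (sw L lam lam') r1 r2 k1 k2) / (L : ℝ) ^ 2

/-- termwise resolvent identity: `wterm(g_λ) − wterm(g_λ') = (λ − λ')·wterm(slope weight)`. [folklore] -/
theorem wterm_gw_sub (L : ℕ) {lam lam' : ℝ} (r1 r2 : ℕ) {k1 k2 : ℕ}
    (hne : ¬ (k1 = 0 ∧ k2 = 0) → 2 * epsN L k1 k2 - lam ≠ 0 ∧ 2 * epsN L k1 k2 - lam' ≠ 0) :
    wterm L (gw L lam) r1 r2 k1 k2 - wterm L (gw L lam') r1 r2 k1 k2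
      = (lam - lam') * wterm L (sw L lam lam') r1 r2 k1 k2 := by
  unfold wterm
  by_cases hk : k1 = 0 ∧ k2 = 0
  · rw [if_pos hk, if_pos hk, if_pos hk]; ring
  · rw [if_neg hk, if_neg hk, if_neg hk]
    obtain ⟨ha, hb⟩ := hne hk
    unfold gw sw
    field_simp
    ring

/-- ★ RESOLVENT IDENTITY ON THE LATTICE SUM: if no denominator vanishes,
`Gres λ r − Gres λ' r = (λ − λ')·slopeSum λ λ' r` (termwise `1/(a−λ) − 1/(a−λ') = (λ−λ')/((a−λ)(a−λ'))`). [folklore] -/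
theorem Gres_sub_Gres (L : ℕ) [NeZero L] {lam lam' : ℝ}
    (hne : ∀ k1 k2 : ℕ, k1 < L → k2 < L → ¬ (k1 = 0 ∧ k2 = 0) → 2 * epsN L k1 k2 - lam ≠ 0 ∧ 2 * epsN L k1 k2 - lam' ≠ 0)
    {r1 r2 : ℕ} (h1 : r1 < L) (h2 : r2 < L) :
    Gres L lam (((r1 : ℕ) : ZMod L), ((r2 : ℕ) : ZMod L)) - Gres L lam' (((r1 : ℕ) : ZMod L), ((r2 : ℕ) : ZMod L))
      = (lam - lam') * slopeSum L lam lam' r1 r2 := by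
  rw [Gres_eq_sum L lam h1 h2, Gres_eq_sum L lam' h1 h2]
  unfold slopeSum
  rw [← sub_div, mul_div_assoc']
  congr 1
  rw [← Finset.sum_sub_distrib, Finset.mul_sum]
  refine Finset.sum_congr rfl fun k1 hk1 => ?_
  rw [← Finset.sum_sub_distrib, Finset.mul_sum]
  refine Finset.sum_congr rfl fun k2 hk2 => ?_
  rw [Finset.mem_range] at hk1 hk2
  exact wterm_gw_sub L r1 r2 (hne k1 k2 hk1 hk2)

/-- entrywise soundness of the product table for two parameters in the same cell. [folklore] -/
theorem mem_gresSqCellTab (L : ℕ) (hL : 3 ≤ L) {lam lam' : ℝ} {la lb : ℤ}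
    (hla : (la : ℝ) ≤ lam * ((D : ℤ) : ℝ)) (hlb : lam * ((D : ℤ) : ℝ) ≤ (lb : ℝ))
    (hla' : (la : ℝ) ≤ lam' * ((D : ℤ) : ℝ)) (hlb' : lam' * ((D : ℤ) : ℝ) ≤ (lb : ℝ))
    (hpos : denCellPos L (cosTab L) la lb = true) :
    ∀ k1 k2 : ℕ, k1 < L → k2 < L → ¬ (k1 = 0 ∧ k2 = 0) →
      mem (sw L lam lam' k1 k2) (getIv ((gresSqCellTab L (cosTab L) la lb).getD k1 []) k2) := by
  intro k1 k2 hk1 hk2 hk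
  unfold gresSqCellTab
  rw [getIv_tab (fun a b => imul (iinv (denCellIv (cosTab L) la lb a b)) (iinv (denCellIv (cosTab L) la lb a b))) hk1 hk2]
  have hp := denCellPos_spec hpos hk1 hk2 hk
  have e : sw L lam lam' k1 k2 = (1 / (2 * epsN L k1 k2 - lam)) * (1 / (2 * epsN L k1 k2 - lam')) := by
    unfold sw; rw [one_div_mul_one_div]
  rw [e]
  exact mem_imul (mem_iinv (mem_denCell L hL hla hlb hk1 hk2) hp) (mem_iinv (mem_denCell L hL hla' hlb' hk1 hk2) hp)

/-- ★ THE CELL SLOPE ENCLOSURE: for `λ, λ'` with `λ·D, λ'·D ∈ [la, lb]`, `slopeSum λ λ' r ∈ GresSlopeIv L la lb r₁ r₂`; with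
`Gres_sub_Gres` this is `|Gres λ r − Gres λ' r| ≤ |λ − λ'| · max |GresSlopeIv|` on the cell. [folklore] -/
theorem mem_GresSlope_cell (L : ℕ) (hL : 3 ≤ L) {lam lam' : ℝ} {la lb : ℤ}
    (hla : (la : ℝ) ≤ lam * ((D : ℤ) : ℝ)) (hlb : lam * ((D : ℤ) : ℝ) ≤ (lb : ℝ))
    (hla' : (la : ℝ) ≤ lam' * ((D : ℤ) : ℝ)) (hlb' : lam' * ((D : ℤ) : ℝ) ≤ (lb : ℝ))
    (hpos : denCellPos L (cosTab L) la lb = true) (r1 r2 : ℕ) :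
    mem (slopeSum L lam lam' r1 r2) (GresSlopeIv L la lb r1 r2) := by
  unfold slopeSum GresSlopeIv
  exact mem_green_of L hL (sw L lam lam') _ (mem_gresSqCellTab L hL hla hlb hla' hlb' hpos) r1 r2

/-- positivity of the denominators on the cell (for `Gres_sub_Gres`): from the positivity check. [folklore] -/
theorem den_ne_zero_of_cell (L : ℕ) (hL : 3 ≤ L) {lam : ℝ} {la lb : ℤ}
    (hla : (la : ℝ) ≤ lam * ((D : ℤ) : ℝ)) (hlb : lam * ((D : ℤ) : ℝ) ≤ (lb : ℝ))
    (hpos : denCellPos L (cosTab L) la lb = true) {k1 k2 : ℕ} (hk1 : k1 < L) (hk2 : k2 < L)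
    (hk : ¬ (k1 = 0 ∧ k2 = 0)) : 0 < 2 * epsN L k1 k2 - lam := by
  have hm := mem_denCell L hL hla hlb hk1 hk2
  have hp := denCellPos_spec hpos hk1 hk2 hk
  obtain ⟨hlo, _⟩ := hm
  have hD := D_pos
  have hp' : (0 : ℝ) < (((denCellIv (cosTab L) la lb k1 k2).1 : ℤ) : ℝ) := by exact_mod_cast hp
  nlinarith

end FinCell

end Summit.HubbardSuperconductivity.HubbardSuperconductivity.Theorems.AnisotropyChord.Transfer.Fibre3
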